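import Literature.MathematicalPhysics.QuantumLattice.InfVolFermionStateTTPrimeMeanEnergyBox
import Literature.MathematicalPhysics.QuantumLattice.HubbardTPPBoxHamiltonian
import Literature.MathematicalPhysics.QuantumLattice.HubbardNNRepulsionInteraction
import HarnessLib

/-!
# The third-neighbour (axial range-2) bond energies and the particle number of a translation-invariant state
# on finite boxes

Topic `MathematicalPhysics/QuantumLattice`, family `hubbard`. The axial twin of
`InfVolFermionStateTTPrimeMeanEnergyBox` (diagonal bonds) and `InfVolFermionStateHubbardMeanEnergyBox`
(nearest-neighbour bonds): for a TRANSLATION-INVARIANT infinite-volume state `ω` on `ℤ^d` the expectations of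
the third-neighbour bond terms `Φ''{x, x + 2e_i}` of `axialRange2HoppingFermionInteraction d t''` do not depend
on `x`; the axial mean-energy observable (range parameter `2`) has expectation `Σ_i ω(Φ''{0, 2e_i})`; the axial
part of the free-boundary box Hamiltonian of a finite `Λ` has expectation
`Σ_i #{x ∈ Λ : x + 2e_i ∈ Λ} · ω(Φ''{0, 2e_i})`; and the box particle number has expectation `|Λ| · ρ(ω)`.
These are the bookkeeping atoms of the infinite-volume Anderson cluster bound for the `t–t'–t''` model
(object M). Everything is proved; no definition, no named fact.

## References

* O. Bratteli, D. W. Robinson, *OAQSM 1* (1987), §4.3.1; *OAQSM 2* (1997), §6.2.4 (Prop. 6.2.38 ff.).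
  [cite: BratteliRobinsonI1987, §4.3.1] [cite: BratteliRobinsonII1997, §6.2.4 (Prop. 6.2.38 ff.)]
* O. Bratteli, A. Kishimoto, D. W. Robinson, CMP 64 (1978) 41, §3. [cite: BratteliKishimotoRobinson1978, §3 (mean energy functional)]
* E. Pavarini et al., Phys. Rev. Lett. 87 (2001) 047003, eq. (1). [cite: PavariniEtAl2001, eq. (1)]
-/

noncomputable section

namespace Literature.MathematicalPhysics.QuantumLattice

open Matrix Finset HubbardWave0 Literature.Probability.LatticeModels ThermodynamicLimit
open scoped ComplexOrder

variable {d : ℕ} (t'' : ℝ)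

namespace InfVolFermionState

/-- `shiftSet x {0, 0 + v} ⊆ {x, x + v}`. [folklore] -/
private theorem shiftSet_pair_zero_subset_ax (x v : Site d) :
    shiftSet x ({0, 0 + v} : Finset (Site d)) ⊆ {x, x + v} := by
  intro y hy
  rw [mem_shiftSet, mem_insert, mem_singleton] at hy
  rw [mem_insert, mem_singleton]
  rcases hy with h | h
  · exact Or.inl (sub_eq_zero.1 h)
  · right; rw [zero_add] at h; rw [← sub_add_cancel y x, h, add_comm]

variable {ω : InfVolFermionState d}

/-- **The third-neighbour bond energy does not depend on the bond**: for translation-invariant `ω`,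
`ω(Φ''{x, x + 2e_i}) = ω(Φ''{0, 2e_i})`. [cite: BratteliRobinsonI1987, §4.3.1] -/
theorem IsTranslationInvariant.expect_axial2_pair (hω : ω.IsTranslationInvariant) (x : Site d) (i : Fin d) :
    ω.expect {x, x + axial2Vec i} ((axialRange2HoppingFermionInteraction d t'').Φ {x, x + axial2Vec i}) =
      ω.expect {0, 0 + axial2Vec i} ((axialRange2HoppingFermionInteraction d t'').Φ {0, 0 + axial2Vec i}) := by
  conv_rhs => rw [← hω x, shift_expect]
  refine ω.expect_fermionEmbed_incl_eq (subset_refl _) (shiftSet_pair_zero_subset_ax x (axial2Vec i)) _ _ ?_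
  have hc : ∀ (y : Site d) (hy : y ∈ ({0, 0 + axial2Vec i} : Finset (Site d))) (σ : Fin 2),
      fermionEmbed ((PolySite.shiftEmb x {0, 0 + axial2Vec i}).trans
        (PolySite.incl (shiftSet_pair_zero_subset_ax x (axial2Vec i))))
        (cAt y hy σ) = cAt (y + x) (shiftSet_pair_zero_subset_ax x (axial2Vec i) (PolySite.add_mem_shiftSet x hy)) σ := by
    intro y hy σ
    rw [cAt, fermionEmbed_annihilation]
    rfl
  have h0 : ∀ (h : 0 + x ∈ ({x, x + axial2Vec i} : Finset (Site d))) (h' : x ∈ ({x, x + axial2Vec i} : Finset (Site d)))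
      (σ : Fin 2), cAt (0 + x) h σ = cAt x h' σ := fun h h' σ => cAt_congr h h' (zero_add x) σ
  have h1 : ∀ (h : 0 + axial2Vec i + x ∈ ({x, x + axial2Vec i} : Finset (Site d)))
      (h' : x + axial2Vec i ∈ ({x, x + axial2Vec i} : Finset (Site d))) (σ : Fin 2),
      cAt (0 + axial2Vec i + x) h σ = cAt (x + axial2Vec i) h' σ := fun h h' σ =>
    cAt_congr h h' (by rw [zero_add, add_comm]) σ
  simp only [axialRange2HoppingFermionInteraction_apply_pair, fermionEmbed_smul, fermionEmbed_sum, fermionEmbed_add,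
    fermionEmbed_mul, fermionEmbed_conjTranspose, fermionEmbed_fermionEmbed, fermionEmbed_incl_cAt, hc,
    h0 _ (mem_insert_self _ _), h1 _ (mem_insert_of_mem (mem_singleton_self _))]

/-- **The axial mean-energy observable through the bond expectations** (range parameter `2`): for
translation-invariant `ω`, `ω(E^{t''}) = Σ_i ω(Φ''{0, 2e_i})`. [cite: BratteliKishimotoRobinson1978, §3 (mean energy functional)] -/
theorem IsTranslationInvariant.expect_axial2_meanEnergyObs (hω : ω.IsTranslationInvariant) :
    ω.expect (thicken ({0} : Finset (Site d)) 2) ((axialRange2HoppingFermionInteraction d t'').meanEnergyObs 2) =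
      ∑ i : Fin d, ω.expect {0, 0 + axial2Vec i} ((axialRange2HoppingFermionInteraction d t'').Φ {0, 0 + axial2Vec i}) := by
  rw [axialRange2HoppingFermionInteraction_meanEnergyObs, map_sum]
  refine Finset.sum_congr rfl fun i _ => ?_
  rw [map_add, map_smul, map_smul, ω.compatible, ω.compatible]
  have h := hω.expect_axial2_pair t'' (-axial2Vec i) i
  rw [h, ← add_smul]
  norm_num

/-- **The axial part of the box Hamiltonians through the bond expectations**: for translation-invariant `ω`
and every finite region `Λ ⊆ ℤ^d`, `ω(H^{t''}_Λ) = Σ_i #{x ∈ Λ : x + 2e_i ∈ Λ} · ω(Φ''{0, 2e_i})`.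
[cite: BratteliRobinsonII1997, §6.2.4 (Prop. 6.2.38 ff.)] -/
theorem IsTranslationInvariant.expect_axial2_localHamiltonian (hω : ω.IsTranslationInvariant)
    (Λ : Finset (Site d)) :
    ω.expect Λ ((axialRange2HoppingFermionInteraction d t'').localHamiltonian Λ) =
      ∑ i : Fin d, ((Λ.filter fun x => x + axial2Vec i ∈ Λ).card : ℂ) *
        ω.expect {0, 0 + axial2Vec i} ((axialRange2HoppingFermionInteraction d t'').Φ {0, 0 + axial2Vec i}) := by
  classical
  rw [FermionInteraction.localHamiltonian_eq_sum, map_sum]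
  have hterm : ∀ X : Finset (Site d), ω.expect Λ (if h : X ⊆ Λ then
      fermionEmbed (PolySite.incl h) ((axialRange2HoppingFermionInteraction d t'').Φ X) else 0) =
      if X ⊆ Λ then ω.expect X ((axialRange2HoppingFermionInteraction d t'').Φ X) else 0 := by
    intro X
    by_cases h : X ⊆ Λ
    · rw [dif_pos h, if_pos h, ω.compatible]
    · rw [dif_neg h, if_neg h, map_zero]
  simp_rw [hterm]
  rw [sum_powerset_eq_of_axial2_support Λ _ (fun X hX => by
    rw [axialRange2HoppingFermionInteraction_apply_eq_zero t'' hX, map_zero, ite_self])]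
  rw [Finset.sum_filter, Finset.sum_product, Finset.sum_comm]
  refine Finset.sum_congr rfl fun i _ => ?_
  rw [Finset.card_filter, Nat.cast_sum, Finset.sum_mul]
  refine Finset.sum_congr rfl fun x hx => ?_
  by_cases h : x + axial2Vec i ∈ Λ
  · rw [if_pos h, if_pos (insert_subset hx (singleton_subset_iff.2 h)), hω.expect_axial2_pair t'' x i, if_pos h,
      Nat.cast_one, one_mul]
  · rw [if_neg h, if_neg h, Nat.cast_zero, zero_mul]

/-! ### The box particle number of a translation-invariant state -/

/-- **The box particle number through the site densities**: `Re ω(N_Λ) = Σ_{x ∈ Λ} ρ_x(ω)` (every state).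
[cite: BratteliRobinsonII1997, §6.2.4 (Prop. 6.2.38 ff.)] -/
theorem re_expect_totalNumber_eq_sum_densityAt (ω : InfVolFermionState d) (Λ : Finset (Site d)) :
    (ω.expect Λ (totalNumber : FermionOp Λ)).re = ∑ x ∈ Λ, ω.densityAt x := by
  classical
  let e : PolySite Λ ≃ {x // x ∈ Λ} :=
    ⟨fun a => ⟨ofLex a.1, PolySite.ofLex_mem a⟩, fun x => PolySite.pt x.1 x.2, fun a => PolySite.pt_ofLex a,
      fun x => Subtype.ext rfl⟩
  have hsum : (totalNumber : FermionOp Λ) =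
      ∑ x ∈ Λ.attach, (numberOp (PolySite.pt x.1 x.2) 0 + numberOp (PolySite.pt x.1 x.2) 1) := by
    rw [totalNumber, ← Finset.univ_eq_attach]
    refine Fintype.sum_equiv e _ _ fun a => ?_
    rw [Fin.sum_univ_two, show PolySite.pt (e a).1 (e a).2 = e.symm (e a) from rfl, Equiv.symm_apply_apply]
  have hterm : ∀ x : {x // x ∈ Λ},
      (ω.expect Λ (numberOp (PolySite.pt x.1 x.2) 0 + numberOp (PolySite.pt x.1 x.2) 1)).re = ω.densityAt x.1 := by
    intro x
    have hcomp : ∀ σ : Fin 2, ω.expect Λ (numberOp (PolySite.pt x.1 x.2) σ) =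
        ω.expect {x.1} (nAt x.1 (mem_singleton_self x.1) σ) := by
      intro σ
      rw [← ω.compatible (singleton_subset_iff.2 x.2) (nAt x.1 (mem_singleton_self x.1) σ), nAt,
        fermionEmbed_numberOp, PolySite.incl_pt]
    rw [map_add, hcomp, hcomp, ← map_add, InfVolFermionState.densityAt]
  rw [hsum, map_sum, Complex.re_sum, Finset.sum_congr rfl fun x _ => hterm x, Finset.sum_attach Λ fun x => ω.densityAt x]

/-- **Translation-invariant states**: `Re ω(N_Λ) = |Λ| · ρ(ω)`. [cite: BratteliRobinsonII1997, §6.2.4 (Prop. 6.2.38 ff.)] -/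
theorem IsTranslationInvariant.re_expect_totalNumber_eq_card_mul_density (hω : ω.IsTranslationInvariant)
    (Λ : Finset (Site d)) :
    (ω.expect Λ (totalNumber : FermionOp Λ)).re = (Λ.card : ℝ) * ω.density := by
  rw [ω.re_expect_totalNumber_eq_sum_densityAt Λ, Finset.sum_congr rfl fun x _ => hω.densityAt_eq_density x,
    Finset.sum_const, nsmul_eq_mul]

end InfVolFermionState

end Literature.MathematicalPhysics.QuantumLattice

end
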